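import Mathlib.AlgebraicTopology.FundamentalGroupoid.SimplyConnected
import Literature.Geometry.Lorentzian.IPlusRegular
import Literature.Geometry.Lorentzian.Einstein
import HarnessLib

/-!
# Spherical topology of the cross-sections of the event horizon of an `I⁺`-regular black hole
# (Chruściel–Wald 1994, Thm. 2.3 (2); Chruściel–Costa 2008, Cor. 2.5)

One NAMED FACT (D-0014), `chruscielWald1994_crossSectionSphere`: in a four-dimensional vacuum
`I⁺`-regular stationary asymptotically flat black hole with simply connected domain of outer
communications, every connected component of the compact cross-section `∂S̄ = S̄ ∖ S` of the event
horizon `𝓔⁺` provided by the hypersurface `S` of Definition 1.1 (`I⁺`-regularity) is homeomorphic to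
the `2`-sphere.

Printed statements.

* P. T. Chruściel, R. M. Wald, *On the topology of stationary black holes*, Class. Quantum Grav.
  **11** (1994) L147–L152 = gr-qc/9410004, **Thm. 2.3**: "Let `(M, g)` be a stationary,
  asymptotically flat spacetime containing a single asymptotically flat region whose domain of outer
  communications, `⟨⟨J⟩⟩`, is globally hyperbolic. Suppose that the null energy condition holds. Then
  (1) `⟨⟨J⟩⟩` is simply connected. (2) Suppose that there exists an achronal, asymptotically flat
  slice, `𝒮`, of `⟨⟨J⟩⟩`, whose boundary in `M` intersects the event horizon, `ℋ`, of any black holes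
  in `M` in a cross-section, `K`. If `K` is compact and if `𝒞' ∖ 𝒞_ext` has compact closure in `M`,
  then each connected component of `K` is homeomorphic to a sphere."  (Remark 1 there: with (1),
  Hempel's Lemma 4.9 gives the same for `∂Σ̄` when `Σ` is the interior of a compact manifold with
  boundary.)
* P. T. Chruściel, J. Lopes Costa, *On uniqueness of stationary vacuum black holes*, Astérisque
  **321** (2008) 195–265 = arXiv:0806.0016, §2.4, **Cor. 2.5** (after Cor. 2.4 = simple
  connectedness of a globally hyperbolic asymptotically flat d.o.c. satisfying the null energy
  condition, via Galloway / Chruściel–Wald): "In `I⁺`-regular, stationary, asymptotically flat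
  space-times satisfying the null energy condition, cross-sections of `𝓔⁺` have spherical topology"
  (space-time dimension four; "see [ChWald] together with Proposition 4.4 below", Prop. 4.4 supplying
  the compactness of `closure (𝒞⁺ ∖ M_ext)` under `I⁺`-regularity).

Rendering (weaker than print).  For a `StationaryAFBlackHole` (`Stationary.lean`: a `4`-dimensional
spacetime with complete stationary Killing field, one designated asymptotically flat end, `M_ext`,
`⟨⟨M_ext⟩⟩ = 𝓑.doc`, `𝓔⁺ = 𝓑.horizon`) which is `I⁺`-regular (`IsIPlusRegular`, `IPlusRegular.lean`:
`⟨⟨M_ext⟩⟩` globally hyperbolic and the hypersurface of Def. 1.1 exists) and VACUUM (`IsRicciFlat`,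
which implies the null energy condition), with `SimplyConnectedSpace 𝓑.doc` ASSUMED (print derives
it, Cor. 2.4 / Thm. 2.3 (1) — a weakening, as in the companion facts
`chruscielCosta2008_docProductStructure`, `DegenerateVacuumHorizonNoCollar`), and for EVERY
hypersurface `𝒮 : 𝓑.IPlusRegularHypersurface` of Def. 1.1 (data: a smooth spacelike acausal
connected hypersurface `S = range 𝒮.f ⊇ Σ_ext` of the d.o.c. whose closure `S̄` is a `C⁰` manifold
with boundary, union of a compact set and finitely many asymptotically flat ends, with boundary
`∂S̄ := S̄ ∖ S ⊆ 𝓔⁺` a cross-section of `𝓔⁺` — so `∂S̄` is the compact cross-section `K` of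
Thm. 2.3 (2) and `S` the achronal asymptotically flat slice): every connected component of `∂S̄`
(`connectedComponentIn`) is homeomorphic to the unit sphere of `ℝ³`.  The reduction of several
asymptotic ends of `S̄` to the single region of Thm. 2.3 is Chruściel–Wald's Prop. 2.1 /
Chruściel–Costa's Thm. 2.3 (topological censorship under the null energy condition), part of the
printed provenance of Cor. 2.5.

This fact is STRICTLY WEAKER in content than the accepted composite fact
`chruscielCosta2008_horizonSphericalSection` (`HorizonSphericalSection.lean`, p155351: CC08 Thm. 4.11
+ Prop. 4.3 + Cor. 2.5 — existence of a SMOOTH spacelike spherical cross-section): it keeps only the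
purely topological Cor. 2.5 about the GIVEN `C⁰` cross-section; the smoothing (Thm. 4.11, Prop. 4.3)
is proved in the tree by the line lead of crux stmt-FinalStateConjecture-17840 (programme "SEC",
`Summits/FinalStateConjecture/FinalStateConjecture/Theorems/ZeroEnergyKerrOrBombHawkingExtensionIsKerrSEC*.lean`),
for which this statement is the residual input: a component `C₁ ≃ₜ S²` of `∂S̄` carries leaf
coordinates of the horizon's null generator foliation, hence a smooth structure, and a smooth
spacelike section over it.

-- TODO(general form): the null energy condition instead of vacuum; simple connectedness of the
-- d.o.c. derived (Cor. 2.4) rather than assumed; arbitrary compact cross-sections `K` of `𝓔⁺`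
-- bounding an achronal asymptotically flat slice (not only the `∂S̄` of Def. 1.1); the statement
-- `𝓔⁺ ≈ ℝ × K` (Chruściel–Wald, §2).

## References

* P. T. Chruściel, R. M. Wald, Class. Quantum Grav. 11 (1994) L147–L152, gr-qc/9410004, Thm. 2.3
  and Remark 1. [ChruscielWald1994Topology]
* P. T. Chruściel, J. Lopes Costa, Astérisque 321 (2008) 195–265, arXiv:0806.0016, Def. 1.1, §2.4
  (Cor. 2.4, Cor. 2.5), §4.2 (Prop. 4.4). [ChruscielCosta2008]
* J. Hempel, *3-Manifolds*, Ann. of Math. Studies 86, Princeton 1976, Lemma 4.9.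
-/

noncomputable section

open Set
open scoped Manifold ContDiff Topology

namespace Literature.Geometry.Lorentzian

/-- **Spherical topology of horizon cross-sections (Chruściel–Wald 1994, Thm. 2.3 (2);
Chruściel–Costa 2008, Cor. 2.5; named fact, D-0014).**  For a four-dimensional vacuum, `I⁺`-regular
stationary asymptotically flat black hole `𝓑` with simply connected domain of outer communications
and every hypersurface `𝒮` of Chruściel–Costa's Definition 1.1 (`IPlusRegularHypersurface`: its
closure `S̄` is a topological manifold with boundary whose boundary `∂S̄ = S̄ ∖ S` is a compact
cross-section of `𝓔⁺ = 𝓑.horizon`), every connected component of `∂S̄` is homeomorphic to the unit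
`2`-sphere.  Printed: Chruściel–Wald Thm. 2.3 (2) ("each connected component of `K` is homeomorphic
to a sphere", for the compact cross-section `K` in which the boundary of an achronal asymptotically
flat slice meets the horizon, in a stationary asymptotically flat space-time with globally
hyperbolic d.o.c. satisfying the null energy condition) = Chruściel–Costa Cor. 2.5 ("in `I⁺`-regular
stationary asymptotically flat space-times satisfying the null energy condition, cross-sections of
`𝓔⁺` have spherical topology", dimension four, with their Prop. 4.4).  Weaker than print, see the
module docstring.
[cite: ChruscielWald1994Topology, Thm. 2.3 (2)] [cite: ChruscielCosta2008, Cor. 2.5] -/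
def chruscielWald1994_crossSectionSphere : Prop :=
  ∀ (𝓑 : StationaryAFBlackHole.{0}) [𝓑.metric.HasLeviCivita],
    𝓑.metric.toPseudoRiemannianMetric.IsRicciFlat → 𝓑.IsIPlusRegular → SimplyConnectedSpace 𝓑.doc →
    ∀ (𝒮 : 𝓑.IPlusRegularHypersurface),
      ∀ y ∈ closure (Set.range 𝒮.f) \ Set.range 𝒮.f,
        Nonempty (↥(connectedComponentIn (closure (Set.range 𝒮.f) \ Set.range 𝒮.f) y) ≃ₜ
          Metric.sphere (0 : E3) 1)

/-- Hypothesis form of `chruscielWald1994_crossSectionSphere`: tautological unfolding.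
Chruściel–Wald 1994, Thm. 2.3 (2). [cite: ChruscielWald1994Topology, Thm. 2.3 (2)] -/
theorem chruscielWald1994_crossSectionSphere.apply (h : chruscielWald1994_crossSectionSphere)
    (𝓑 : StationaryAFBlackHole.{0}) [𝓑.metric.HasLeviCivita]
    (hvac : 𝓑.metric.toPseudoRiemannianMetric.IsRicciFlat) (hreg : 𝓑.IsIPlusRegular)
    (hsc : SimplyConnectedSpace 𝓑.doc) (𝒮 : 𝓑.IPlusRegularHypersurface) {y : 𝓑.carrier}
    (hy : y ∈ closure (Set.range 𝒮.f) \ Set.range 𝒮.f) :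
    Nonempty (↥(connectedComponentIn (closure (Set.range 𝒮.f) \ Set.range 𝒮.f) y) ≃ₜ
      Metric.sphere (0 : E3) 1) :=
  h 𝓑 hvac hreg hsc 𝒮 y hy

end Literature.Geometry.Lorentzian

end
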